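/-
Copyright (c) 2026 the pub-hodgecm-mathlib formalisation cell (harness21).  Prover seat hodgecm-mathlib-K2Liu-p01 (g6), Track B «K2-LIT»,
Road I organ (A-int)-fin, A2 «mixed-model equivariance of the Kudla–Rallis ∕ Ikeda map `r_w`», file A2a (LEAD F0P6-plan (g12) 07:27:52Z (b);
heads `K2/K2Liu-p01/g6/HEADS-A2-KudlaRallisMapEquivariance.K2Liu-p01-g6.md`).  KERNEL: theorems only.
-/
import Summits.HodgeConjecture.HodgeConjecture.Theorems.K2LiuKudlaRallisMapDefs          -- ★ β-2 p858271 `krPoint`, `krFun`, `krMap`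
import Summits.HodgeConjecture.HodgeConjecture.Theorems.K2LiuFiberIntegralSubstitution   -- ★ p858287 fibre integrals under block-triangular substitutions
import HarnessLib

/-!
# Crux `HLiu418`, Track B road `K2_Liu`, Road I organ (A-int)-fin — A2a: EQUIVARIANCE OF THE KUDLA–RALLIS ∕ IKEDA MAP `r = krMap θ μ`
# under the slice-parabolic: substitutions, fibre-constant multipliers, and the Heisenberg group

Cell `hodgecm-mathlib`, crux item hLiu418 = `stmt-HodgeConjecture-24832`, route of record `HCCMUnconditional`; squad K2 ∕ K2Liu, prover K2Liu-p01 (g6).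
THEOREMS ONLY (no `def`, no instance, no notation, no named fact, no `sorry`); lane `--supports stmt-HodgeConjecture-24832 --as helper`.

Setting of ★ β-2 `K2LiuKudlaRallisMapDefs`: a mixed-model frame `θ : X ≃ₜ ((β ⊕ γ) ⊕ α → F)` (kept block `β`, killed block `γ`, integrated block `α`), a measure
`μ` on the fibre `α → F`, the slice points `krPoint θ u a = θ⁻¹((u ⊔ 0) ⊔ a)` and the map `(r Φ)(u) = krFun θ μ Φ u = ∫ Φ (krPoint θ u a) dμ(a)` — at a finite
place `w` of the Road I sheet this is Ikeda's map `Ik(φ)(a) = ∫_{Y* ⊗ X′} φ(x, a, 0) dx` [GanQiuTakeda2014, §2.7], `r_w = krMap θ_w μ_w` (SIGS §A-int PIN (b)).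
Its equivariance [GanQiuTakeda2014, §2.8: «the Ikeda map is `G_n × H_{r′}`-equivariant»] under everything that respects the slices is proved here GENERICALLY:

* §1 LINEAR CLAUSE `krFun_comp_of_slice` — a substitution `S` of `X` which is block lower-triangular on the slices,
  `θ (S (krPoint θ u a)) = (A u ⊔ 0) ⊔ (D a + c u)` (`D ∈ GL_α(K)`, base moved by any `A`, fibre sheared by any `c u`), costs the module `‖det D‖_K⁻¹`:
  `r (Φ ∘ S) (u) = ‖det D‖_K⁻¹ · (r Φ)(A u)` (★ p858287).  Instances: the Siegel Levi `M_Δ` of the doubled group (block diagonal), the Levi `GL(X′) × U(a′_w)` and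
  the unipotent radical `N′` of the parabolic `P′_w = Stab_{U(V′_w)}(X′)` — ★ `leviOp` form `krFun_leviOp`.
* §2 CHARACTER CLAUSE `krFun_mul_of_sliceConst` — a multiplier constant along each slice comes out; ★ `unipotentOp` form `krFun_unipotentOp`
  (the Siegel unipotent radical `N_Δ`: `ψ(tr(b·Q(x)))` is constant on the slices because `X′` is isotropic and orthogonal to `a′_w`).
* §3 HEISENBERG CLAUSE `krFun_schrodinger` — for `θ` additive, `r` intertwines the Schrödinger operator of `h = ((x₀, y₀), t)` on `X` with the Schrödinger
  operator of `((u₀, y₀′), t)` on `F^β` as soon as `θ x₀ = (u₀ ⊔ 0) ⊔ a₀` (no `γ`-component) and `B (krPoint θ u a) y₀ = B_β u y₀′` (modulation constant on the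
  slices): translations along the fibre and modulations trivial on the slices die — the characterisation of `Ik` as `id ⊗ λ`, `λ` the invariant functional of the
  Lagrangian `W ⊗ X′` [MoeglinVignerasWaldspurger1987, Chap. 2 II.6; Chap. 3 IV (modèles mixtes)].
* §4 the same at the Schwartz–Bruhat level for ★ `krMap θ μ` and ★ `schrodingerSB`.
NOT here: the Weyl-element ∕ Fourier clause (file A2b) and the instantiation at ★ β-1 `localSchrodingerDelta` (file A2c).  CAVEAT recorded in the heads memo (W3):
`r` is `P′_w`-equivariant, NOT `U(V′_w)`-invariant per `Φ`, not even after the Siegel–Weil section of `a′_w` (Weyl element of `U(V′_w)` as witness).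

HONEST LABEL: HC_CM is proved only modulo the printed citations (2 remaining named inputs: hLiu418 = stmt-HodgeConjecture-24832, h413 = stmt-HodgeConjecture-24833)
until rung 0 closes; generic helper, closes no item.
References: [GanQiuTakeda2014] W. T. Gan, Y. Qiu, S. Takeda, Invent. Math. 198 (2014), §2.7–2.8, Prop. 4.3 (arXiv:1207.4709 pp. 9–10, 15–16); [KudlaRallis1994] §1;
[Ikeda1996] T. Ikeda, Compositio Math. 103 (1996) §1; [MoeglinVignerasWaldspurger1987] Chap. 2 I.4, II.6, Chap. 3 IV; [Weil1964] n° 11, n° 13; [WeilBNT1967] Ch. I §2 Prop. 2 Cor. 3.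
-/

set_option autoImplicit false
set_option linter.dupNamespace false -- the mandated namespace repeats `HodgeConjecture.HodgeConjecture`

noncomputable section

open MeasureTheory MeasureTheory.Measure Matrix Topology
open scoped NNReal ENNReal
open Literature.NumberTheory.GaloisRepresentations.IsNonarchimedeanLocalField
open Literature.NumberTheory.Automorphic Literature.RepresentationTheory.HeisenbergGroup
open Summit.HodgeConjecture.HodgeConjecture.Cruxes.HLiu418.K2LiuLocalMatrixHaarChar
open Summit.HodgeConjecture.HodgeConjecture.Cruxes.HLiu418.K2LiuFiberIntegralSubstitution
open Summit.HodgeConjecture.HodgeConjecture.Cruxes.HLiu418.K2LiuKudlaRallisMapDefs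

namespace Summit.HodgeConjecture.HodgeConjecture.Cruxes.HLiu418.K2LiuKudlaRallisMapEquivariance

/-! ## §0 Slice bookkeeping -/

section Slices

variable {X : Type*} [TopologicalSpace X] {F : Type*} [TopologicalSpace F] {α β γ : Type*}

/-- two slice points with the same frame coordinates are equal. [cite: KudlaRallis1994, §1] -/
theorem eq_krPoint_of_apply_eq [Zero F] (θ : X ≃ₜ ((β ⊕ γ) ⊕ α → F)) {x : X} {u : β → F} {a : α → F}
    (h : θ x = Sum.elim (Sum.elim u 0) a) : x = krPoint θ u a := by
  rw [krPoint_eq, ← h, Homeomorph.symm_apply_apply]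

omit [TopologicalSpace F] in
/-- frame coordinates add blockwise: `((u ⊔ 0) ⊔ a) + ((u₀ ⊔ 0) ⊔ a₀) = ((u + u₀) ⊔ 0) ⊔ (a + a₀)`. [folklore] -/
theorem sumElim_sumElim_zero_add [AddZeroClass F] (u u₀ : β → F) (a a₀ : α → F) :
    Sum.elim (Sum.elim u (0 : γ → F)) a + Sum.elim (Sum.elim u₀ (0 : γ → F)) a₀ = Sum.elim (Sum.elim (u + u₀) 0) (a + a₀) := by
  ext i
  rcases i with (b | j) | i
  · rfl
  · exact zero_add 0
  · rfl

/-- for an ADDITIVE frame, translating a slice point by `x₀` with `θ x₀ = (u₀ ⊔ 0) ⊔ a₀` moves to the slice point over `u + u₀` with fibre coordinate `a + a₀`.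
[cite: KudlaRallis1994, §1] -/
theorem krPoint_add [AddZeroClass F] [Add X] (θ : X ≃ₜ ((β ⊕ γ) ⊕ α → F)) (hθ : ∀ x x' : X, θ (x + x') = θ x + θ x')
    {x₀ : X} {u₀ : β → F} {a₀ : α → F} (hx₀ : θ x₀ = Sum.elim (Sum.elim u₀ 0) a₀) (u : β → F) (a : α → F) :
    krPoint θ u a + x₀ = krPoint θ (u + u₀) (a + a₀) :=
  eq_krPoint_of_apply_eq θ (by rw [hθ, apply_krPoint, hx₀, sumElim_sumElim_zero_add])

end Slices

/-! ## §1 The linear clause: block lower-triangular substitutions on the slices -/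

section Linear

variable {X : Type*} [TopologicalSpace X] {K : Type*} [Field K] [ValuativeRel K] [TopologicalSpace K] [IsNonarchimedeanLocalField K]
  [MeasurableSpace K] [BorelSpace K] [SecondCountableTopology K] {α β γ : Type*} [Fintype α] [DecidableEq α]
  [MeasurableSpace (α → K)] [BorelSpace (α → K)] (θ : X ≃ₜ ((β ⊕ γ) ⊕ α → K)) (μ : Measure (α → K)) [μ.IsAddHaarMeasure]

/-- **LINEAR CLAUSE OF THE KUDLA–RALLIS ∕ IKEDA MAP**: if a substitution `S : X → X` maps the slice over `u` affinely onto the slice over `A u`,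
`θ (S (krPoint θ u a)) = (A u ⊔ 0) ⊔ (D a + c u)` with `D ∈ GL_α(K)`, then `r (Φ ∘ S) (u) = ‖det D‖_K⁻¹ · (r Φ)(A u)` (`μ` any Haar measure on `K^α`; the module of
`a ↦ D a` is `‖det D‖_K`, ★ `addEquivAddHaarChar_mulVec_eq_normAbs`).  Covers the Siegel Levi `M_Δ` of the doubled group and the Levi and unipotent radical of
`P′_w = Stab_{U(V′_w)}(X′)` acting linearly in the doubling-polarised model. [cite: GanQiuTakeda2014, §2.8] [cite: KudlaRallis1994, §1] [cite: WeilBNT1967, Ch. I §2 Prop. 2 Cor. 3] -/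
theorem krFun_comp_of_slice (S : X → X) (A : (β → K) → (β → K)) (c : (β → K) → (α → K)) (D : Matrix α α K) (hD : IsUnit D.det)
    (hS : ∀ (u : β → K) (a : α → K), θ (S (krPoint θ u a)) = Sum.elim (Sum.elim (A u) 0) (D *ᵥ a + c u)) (Φ : X → ℂ) (u : β → K) :
    krFun θ μ (Φ ∘ S) u = ((normAbs K D.det)⁻¹ : ℝ≥0) • krFun θ μ Φ (A u) := by
  -- the Borel σ-algebra carried as an instance hypothesis IS the product σ-algebra (second countability): align the instances (as in ★ p858287)
  have hms : ‹MeasurableSpace (α → K)› = MeasurableSpace.pi :=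
    (BorelSpace.measurable_eq (α := α → K)).trans (@BorelSpace.measurable_eq (α → K) _ MeasurableSpace.pi _).symm
  subst hms
  obtain ⟨L, hL⟩ := exists_continuousAddEquiv_mulVec D hD
  have h1 : ∀ a : α → K, (Φ ∘ S) (krPoint θ u a) = (Φ ∘ θ.symm) (Sum.elim (Sum.elim (A u) (0 : γ → K)) (L a + c u)) := fun a => by
    rw [Function.comp_apply, Function.comp_apply, hL, ← hS u a, Homeomorph.symm_apply_apply]
  unfold krFun
  simp_rw [h1]
  rw [integral_sumElim_comp_continuousAddEquiv_add μ (Φ ∘ θ.symm) (Sum.elim (A u) (0 : γ → K)) L (c u)]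
  congr 2
  · convert addEquivAddHaarChar_mulVec_eq_normAbs D hD L hL

/-- **the unimodular case** (`‖det D‖_K = 1`: `D` unipotent, a permutation, in `GL_α(𝒪_K)`, or `D = 1` for the shears of `N′`): `r (Φ ∘ S) (u) = (r Φ)(A u)`.
[cite: GanQiuTakeda2014, §2.8] [cite: KudlaRallis1994, §1] -/
theorem krFun_comp_of_slice_of_normAbs_eq_one (S : X → X) (A : (β → K) → (β → K)) (c : (β → K) → (α → K)) (D : Matrix α α K)
    (hD : normAbs K D.det = 1) (hS : ∀ (u : β → K) (a : α → K), θ (S (krPoint θ u a)) = Sum.elim (Sum.elim (A u) 0) (D *ᵥ a + c u))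
    (Φ : X → ℂ) (u : β → K) : krFun θ μ (Φ ∘ S) u = krFun θ μ Φ (A u) := by
  have hD' : IsUnit D.det := by
    refine isUnit_iff_ne_zero.2 fun h0 => ?_
    rw [h0, map_zero] at hD
    exact zero_ne_one hD
  rw [krFun_comp_of_slice θ μ S A c D hD' hS Φ u, hD, inv_one, one_smul]

/-- **the pure fibre shear ∕ base move** (`D = 1`): `θ (S (krPoint θ u a)) = (A u ⊔ 0) ⊔ (a + c u)` ⇒ `r (Φ ∘ S) (u) = (r Φ)(A u)` — the unipotent radical `N′` of `P′_w`
(`x ↦ x + s(u)`) and the factor `U(a′_w)` (`A = g₀ ⊗ 1`, fibre untouched). [cite: GanQiuTakeda2014, §2.8] [cite: KudlaRallis1994, §1] -/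
theorem krFun_comp_of_slice_shear (S : X → X) (A : (β → K) → (β → K)) (c : (β → K) → (α → K))
    (hS : ∀ (u : β → K) (a : α → K), θ (S (krPoint θ u a)) = Sum.elim (Sum.elim (A u) 0) (a + c u)) (Φ : X → ℂ) (u : β → K) :
    krFun θ μ (Φ ∘ S) u = krFun θ μ Φ (A u) :=
  krFun_comp_of_slice_of_normAbs_eq_one θ μ S A c 1 (by rw [Matrix.det_one, map_one]) (fun u a => by rw [hS, Matrix.one_mulVec]) Φ u

/-- **★ `leviOp` FORM** (Weil's `d₀(α)` on both sides): for linear automorphisms `aX` of `X` and `aβ` of `K^β` with `θ (aX⁻¹ (krPoint θ u a)) = (aβ⁻¹ u ⊔ 0) ⊔ (D a + c u)`,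
`r (leviOp aX Φ) (u) = ‖det D‖_K⁻¹ · (leviOp aβ (r Φ))(u)` — e.g. the Siegel Levi `m(a) ∈ M_Δ` (`aX = a ⊗ 1_{V′}`, `aβ = a ⊗ 1_{a′}`, `D = a ⊗ 1_{X′}`) and
`GL(X′) ⊂ P′_w` (`aX = 1 ⊗ diag(e, 1, ē⁻¹)`, `aβ = 1`, `D = 1 ⊗ e`: the module `|e|_{E_w}^{-n}`). [cite: Weil1964, n° 13] [cite: GanQiuTakeda2014, §2.8] -/
theorem krFun_leviOp [AddCommGroup X] [Module K X] (aX : X ≃ₗ[K] X) (aβ : (β → K) ≃ₗ[K] (β → K)) (c : (β → K) → (α → K)) (D : Matrix α α K)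
    (hD : IsUnit D.det) (hS : ∀ (u : β → K) (a : α → K), θ (aX.symm (krPoint θ u a)) = Sum.elim (Sum.elim (aβ.symm u) 0) (D *ᵥ a + c u))
    (Φ : X → ℂ) (u : β → K) :
    krFun θ μ (leviOp aX Φ) u = ((normAbs K D.det)⁻¹ : ℝ≥0) • leviOp aβ (krFun θ μ Φ) u := by
  rw [leviOp_apply]
  exact krFun_comp_of_slice θ μ aX.symm aβ.symm c D hD hS Φ u

end Linear

/-! ## §2 The character clause: multipliers constant along the slices -/

section Character

variable {X : Type*} [TopologicalSpace X] {F : Type*} [TopologicalSpace F] [Zero F] {α β γ : Type*} [MeasurableSpace (α → F)]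
  (θ : X ≃ₜ ((β ⊕ γ) ⊕ α → F)) (μ : Measure (α → F))

/-- **CHARACTER CLAUSE**: a multiplier `m : X → ℂ` constant along the slice over `u` comes out of the fibre integral:
`r (m · Φ) (u) = m(krPoint θ u 0) · (r Φ)(u)`. [cite: KudlaRallis1994, §1] [cite: GanQiuTakeda2014, §2.8] -/
theorem krFun_mul_of_sliceConst (m Φ : X → ℂ) (u : β → F) (hm : ∀ a : α → F, m (krPoint θ u a) = m (krPoint θ u 0)) :
    krFun θ μ (fun x => m x * Φ x) u = m (krPoint θ u 0) * krFun θ μ Φ u := by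
  unfold krFun
  simp_rw [hm]
  exact integral_const_mul _ _

/-- **★ `unipotentOp` FORM** (Weil's `t₀(f)`, the Siegel unipotent radical `N_Δ`): if the second-degree datum `q : X → R` is constant along the slice over `u` with
value `qβ u` — for `N_Δ`, `q(x) = tr(b · Q_{V′}(x))` and `Q_{V′}(ξ + u + 0) = Q_{a′}(u)` because `X′` is isotropic and orthogonal to `a′_w` — then
`r (unipotentOp ψ q Φ) (u) = (unipotentOp ψ qβ (r Φ))(u)`: `r` intertwines the two unipotent operators ON THE NOSE. [cite: Weil1964, n° 13] [cite: GanQiuTakeda2014, §2.8] -/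
theorem krFun_unipotentOp {R : Type*} [CommRing R] (ψ : AddChar R Circle) (q : X → R) (qβ : (β → F) → R) (u : β → F)
    (hq : ∀ a : α → F, q (krPoint θ u a) = qβ u) (Φ : X → ℂ) :
    krFun θ μ (unipotentOp ψ q Φ) u = unipotentOp ψ qβ (krFun θ μ Φ) u := by
  rw [unipotentOp_apply]
  have h1 : ∀ a : α → F, unipotentOp ψ q Φ (krPoint θ u a) = ((ψ (-qβ u) : Circle) : ℂ) * Φ (krPoint θ u a) := fun a => by
    rw [unipotentOp_apply, hq]
  unfold krFun
  simp_rw [h1]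
  exact integral_const_mul _ _

end Character

/-! ## §3 The Heisenberg clause: `r` intertwines the Schrödinger operators of the slice-parabolic sub-Heisenberg group -/

section HeisenbergClause

variable {F : Type*} [CommRing F] [TopologicalSpace F] {X : Type*} [TopologicalSpace X] [AddCommGroup X] [Module F X]
  {Y : Type*} [AddCommGroup Y] [Module F Y] {Yβ : Type*} [AddCommGroup Yβ] [Module F Yβ] {α β γ : Type*}
  [MeasurableSpace (α → F)] [MeasurableAdd (α → F)] (θ : X ≃ₜ ((β ⊕ γ) ⊕ α → F)) (μ : Measure (α → F)) [μ.IsAddRightInvariant]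
  (B : X →ₗ[F] Y →ₗ[F] F) (Bβ : (β → F) →ₗ[F] Yβ →ₗ[F] F) (ψ : AddChar F Circle)

/-- **HEISENBERG CLAUSE**: let the frame `θ` be additive, `h = ((x₀, y₀), t) ∈ H(polar B)` with `θ x₀ = (u₀ ⊔ 0) ⊔ a₀` (no `γ`-component) and with modulation constant
on the slices, `B (krPoint θ u a) y₀ = Bβ u y₀′`; then for `hβ = ((u₀, y₀′), t) ∈ H(polar Bβ)`:
`r (ρ_X(h) Φ) = ρ_β(hβ) (r Φ)` — `(ρ(h)Φ)(v) = ψ(t + B v y₀) Φ(v + x₀)` (★ `schrodinger_apply`), the fibre translation `a ↦ a + a₀` is absorbed by the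
right-invariant `μ`.  In particular translations along the fibre (`u₀ = 0`, `y₀ = 0`) and modulations trivial on the slices (`x₀ = 0`, `Bβ u y₀′ = 0`) act
trivially through `r`: `r = id_{𝒮(β)} ⊗ λ` with `λ` the functional invariant under the Lagrangian `W ⊗ X′` of the mixed model.
[cite: MoeglinVignerasWaldspurger1987, Chap. 2 II.6] [cite: GanQiuTakeda2014, §2.8] [cite: Weil1964, n° 11] -/
theorem krFun_schrodinger (hθ : ∀ x x' : X, θ (x + x') = θ x + θ x') (h : Heisenberg (polar B)) (hβ : Heisenberg (polar Bβ)) (a₀ : α → F)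
    (hx : θ h.v.1 = Sum.elim (Sum.elim hβ.v.1 0) a₀) (hy : ∀ (u : β → F) (a : α → F), B (krPoint θ u a) h.v.2 = Bβ u hβ.v.2) (ht : hβ.t = h.t)
    (Φ : X → ℂ) (u : β → F) :
    krFun θ μ (schrodinger B ψ h Φ) u = schrodinger Bβ ψ hβ (krFun θ μ Φ) u := by
  rw [schrodinger_apply, ht]
  have h1 : ∀ a : α → F, schrodinger B ψ h Φ (krPoint θ u a) =
      ((ψ (h.t + Bβ u hβ.v.2) : Circle) : ℂ) * Φ (krPoint θ (u + hβ.v.1) (a + a₀)) := fun a => by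
    rw [schrodinger_apply, hy, krPoint_add θ hθ hx]
  unfold krFun
  simp_rw [h1]
  rw [integral_const_mul]
  congr 1
  exact integral_add_right_eq_self (fun a : α → F => Φ (krPoint θ (u + hβ.v.1) a)) a₀

omit [Module F X] in
/-- **fibre translations die**: for `x₀` inside the integrated block (`θ x₀ = (0 ⊔ 0) ⊔ a₀`), `r (Φ(· + x₀)) = r Φ`. [cite: GanQiuTakeda2014, §2.8] [cite: Weil1964, n° 11] -/
theorem krFun_comp_add_of_fibre (hθ : ∀ x x' : X, θ (x + x') = θ x + θ x') {x₀ : X} {a₀ : α → F}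
    (hx₀ : θ x₀ = Sum.elim (Sum.elim (0 : β → F) (0 : γ → F)) a₀)
    (Φ : X → ℂ) (u : β → F) : krFun θ μ (fun x => Φ (x + x₀)) u = krFun θ μ Φ u := by
  unfold krFun
  have h1 : ∀ a : α → F, Φ (krPoint θ u a + x₀) = Φ (krPoint θ u (a + a₀)) := fun a => by
    rw [krPoint_add θ hθ hx₀, add_zero]
  simp_rw [h1]
  exact integral_add_right_eq_self (fun a : α → F => Φ (krPoint θ u a)) a₀

omit [Module F X] [MeasurableAdd (α → F)] [μ.IsAddRightInvariant] in
/-- **base translations pass through**: for `x₀` inside the kept block (`θ x₀ = (u₀ ⊔ 0) ⊔ 0`), `r (Φ(· + x₀)) (u) = (r Φ)(u + u₀)`. [cite: GanQiuTakeda2014, §2.8] -/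
theorem krFun_comp_add_of_base (hθ : ∀ x x' : X, θ (x + x') = θ x + θ x') {x₀ : X} {u₀ : β → F} (hx₀ : θ x₀ = Sum.elim (Sum.elim u₀ 0) 0)
    (Φ : X → ℂ) (u : β → F) : krFun θ μ (fun x => Φ (x + x₀)) u = krFun θ μ Φ (u + u₀) := by
  unfold krFun
  have h1 : ∀ a : α → F, Φ (krPoint θ u a + x₀) = Φ (krPoint θ (u + u₀) a) := fun a => by
    rw [krPoint_add θ hθ hx₀, add_zero]
  simp_rw [h1]

omit [MeasurableAdd (α → F)] [μ.IsAddRightInvariant] in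
/-- **modulations trivial on the slices die**: if `B (krPoint θ u a) y₀ = 0` for all `a`, then `r (ψ(B · y₀) · Φ) (u) = (r Φ)(u)` — the `W ⊗ X′`-invariance of `λ`.
[cite: MoeglinVignerasWaldspurger1987, Chap. 2 II.6] [cite: GanQiuTakeda2014, §2.8] -/
theorem krFun_modulation_of_sliceZero (y₀ : Y) (u : β → F) (hy : ∀ a : α → F, B (krPoint θ u a) y₀ = 0) (Φ : X → ℂ) :
    krFun θ μ (fun x => ((ψ (B x y₀) : Circle) : ℂ) * Φ x) u = krFun θ μ Φ u := by
  rw [krFun_mul_of_sliceConst θ μ (fun x => ((ψ (B x y₀) : Circle) : ℂ)) Φ u (fun a => by simp only [hy]), hy,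
    AddChar.map_zero_eq_one, Circle.coe_one, one_mul]

end HeisenbergClause

/-! ## §4 The Schwartz–Bruhat level: `krMap θ μ` and `schrodingerSB` -/

section SchwartzLevel

variable {F : Type*} [CommRing F] [TopologicalSpace F] [T2Space F] {X : Type*} [TopologicalSpace X] [AddCommGroup X] [Module F X]
  [IsTopologicalAddGroup X] {Y : Type*} [AddCommGroup Y] [Module F Y] {Yβ : Type*} [AddCommGroup Yβ] [Module F Yβ] {α β γ : Type*}
  [MeasurableSpace (α → F)] [OpensMeasurableSpace (α → F)] [MeasurableAdd (α → F)] (θ : X ≃ₜ ((β ⊕ γ) ⊕ α → F)) (μ : Measure (α → F))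
  [IsFiniteMeasureOnCompacts μ] [μ.IsAddRightInvariant] [IsTopologicalRing F]
  (B : X →ₗ[F] Y →ₗ[F] F) (Bβ : (β → F) →ₗ[F] Yβ →ₗ[F] F) (ψ : AddChar F Circle)

/-- **THE KUDLA–RALLIS MAP INTERTWINES THE TWO SMOOTH SCHRÖDINGER MODELS on the slice-parabolic sub-Heisenberg group** (§3 at the level of ★ `krMap` ∕ ★ `schrodingerSB`):
`krMap θ μ (ρ_X(h) Φ) = ρ_β(hβ) (krMap θ μ Φ)` in `𝒮(F^β)`. [cite: MoeglinVignerasWaldspurger1987, Chap. 2 I.4, II.6] [cite: GanQiuTakeda2014, §2.8] -/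
theorem krMap_schrodingerSB (hψ : IsLocallyConstant (⇑ψ : F → Circle)) (hB : ∀ y : Y, Continuous fun v : X => B v y)
    (hBβ : ∀ y : Yβ, Continuous fun v : β → F => Bβ v y) (hθ : ∀ x x' : X, θ (x + x') = θ x + θ x')
    (h : Heisenberg (polar B)) (hβ : Heisenberg (polar Bβ)) (a₀ : α → F) (hx : θ h.v.1 = Sum.elim (Sum.elim hβ.v.1 0) a₀)
    (hy : ∀ (u : β → F) (a : α → F), B (krPoint θ u a) h.v.2 = Bβ u hβ.v.2) (ht : hβ.t = h.t) (Φ : SchwartzBruhat X) :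
    krMap θ μ (schrodingerSB B ψ hψ hB h Φ) = schrodingerSB Bβ ψ hψ hBβ hβ (krMap θ μ Φ) := by
  refine Subtype.ext (funext fun u => ?_)
  rw [coe_krMap_apply, coe_schrodingerSB, coe_schrodingerSB, coe_krMap_apply]
  exact krFun_schrodinger θ μ B Bβ ψ hθ h hβ a₀ hx hy ht _ u

end SchwartzLevel

section SchwartzLinear

variable {X : Type*} [TopologicalSpace X] {K : Type*} [Field K] [ValuativeRel K] [TopologicalSpace K] [IsNonarchimedeanLocalField K]
  [MeasurableSpace K] [BorelSpace K] [SecondCountableTopology K] [T2Space K] {α β γ : Type*} [Fintype α] [DecidableEq α]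
  [MeasurableSpace (α → K)] [BorelSpace (α → K)] (θ : X ≃ₜ ((β ⊕ γ) ⊕ α → K)) (μ : Measure (α → K)) [μ.IsAddHaarMeasure]

/-- **§1 at the Schwartz–Bruhat level**: for a HOMEOMORPHISM `S` of `X`, block lower-triangular on the slices as in `krFun_comp_of_slice`, and `Φ ∈ 𝒮(X)`:
`(krMap θ μ (Φ ∘ S))(u) = ‖det D‖_K⁻¹ · (krMap θ μ Φ)(A u)` (the pull-back `Φ ∘ S ∈ 𝒮(X)` by ★ `comp_homeomorph_mem_schwartzBruhat`).
[cite: GanQiuTakeda2014, §2.8] [cite: KudlaRallis1994, §1] -/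
theorem krMap_comp_homeomorph_apply (S : X ≃ₜ X) (A : (β → K) → (β → K)) (c : (β → K) → (α → K)) (D : Matrix α α K) (hD : IsUnit D.det)
    (hS : ∀ (u : β → K) (a : α → K), θ (S (krPoint θ u a)) = Sum.elim (Sum.elim (A u) 0) (D *ᵥ a + c u)) (Φ : SchwartzBruhat X) (u : β → K) :
    ((krMap θ μ ⟨(Φ : X → ℂ) ∘ S, K2LiuSchwartzBruhatFiberIntegral.comp_homeomorph_mem_schwartzBruhat S Φ.2⟩ : SchwartzBruhat (β → K)) : (β → K) → ℂ) u =
      ((normAbs K D.det)⁻¹ : ℝ≥0) • ((krMap θ μ Φ : SchwartzBruhat (β → K)) : (β → K) → ℂ) (A u) := by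
  rw [coe_krMap_apply, coe_krMap_apply]
  exact krFun_comp_of_slice θ μ S A c D hD hS _ u

end SchwartzLinear

end Summit.HodgeConjecture.HodgeConjecture.Cruxes.HLiu418.K2LiuKudlaRallisMapEquivariance

end
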